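/-
Copyright (c) 2026 the pub-hodgecm-mathlib formalisation cell (harness21).  Prover seat hodgecm-mathlib-K2E3-p12 (g5), Track B «K2-LIT» ∕ h413
(`stmt-HodgeConjecture-24833`), line `K2_E3_EllipticInputs`, unit U12-d, §L: the socket (12-D) «normalised character bounded near every NON-CENTRAL SINGULAR
semisimple `s`» is VACUOUS for `N ≤ 2` — a semisimple element of `U_N(H)(L⁺_v)`, `N ≤ 2`, is regular or central.  2026-09-04.
-/
import Summits.HodgeConjecture.HodgeConjecture.Theorems.K2E3CharLocIntNearSemisimpleTwoOfIdentity   -- ★ (K2E3-p11): `mem_center_of_isSemisimple_of_not_isRegularElt` (N = 2)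
import Summits.HodgeConjecture.HodgeConjecture.Theorems.K2E3CharLocIntNearSemisimpleLeOne          -- ★ (K2E3-p11): `mem_center_cmDatum_local_of_le_one` (N ≤ 1)
import Summits.HodgeConjecture.HodgeConjecture.Theorems.K2E3LieUnitaryDefs                          -- ★ (K2E3-p12 g3): the U12 §L currency (opens below)
import Literature.NumberTheory.Automorphic.UnitaryGroupBorelInduction                                 -- ★ `unitModulusChar`
import HarnessLib

/-!
# K2_E3 road (h413), §L — (12D-le2): the descent socket (12-D) is vacuous at `N ≤ 2`

Cell `pub/hodgecm-mathlib` (D-0151), Track B, seat K2E3-p12 (g5), §L line lead.  `--supports stmt-HodgeConjecture-24833 --as helper`; THEOREMS ONLY (no definition ∕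
instance ∕ notation ∕ named fact ∕ `sorry`); never imports `Cruxes/…/Lines`.

The hosted socket (12-D) `sig_K2E3NormalizedCharBddNearSingularDescent` (U12 ED. 7 :809, this lineage's SUBSIGS v3) asks for a local bound of the normalised
character near every semisimple `s ∈ U_N(H)(L⁺_v)` which is NEITHER REGULAR NOR CENTRAL — Harish-Chandra's descent to the centraliser `G_s`
[HarishChandra1999, §18].  For `N ≤ 2` there is no such `s`: for `N ≤ 1` the group is abelian (★ `mem_center_cmDatum_local_of_le_one`), and for `N = 2` a
semisimple element with inseparable characteristic polynomial is scalar at some place above `v`, hence central (★ `mem_center_of_isSemisimple_of_not_isRegularElt`,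
every CM field, every non-degenerate hermitian `H`, every finite `v`, split or not).  So the by-`N` leaf (12D-le2) below — the socket's bytes with
`(N : ℕ), N ≤ 2 → ∀ (H …)` — holds outright, and the mathematical content of (12-D) is exactly `N ≥ 3` (first case: `s ~ diag(α, α, β)` in `U(2,1)`,
`G_s = U(2) × U(1)` [Rogawski1990, §3.8]).

* **`normalizedCharBddNearSingularDescent_of_le_two`** — (12-D) for `N ≤ 2` (vacuously).

HONEST LABEL: HC_CM is proved only modulo the 7 printed citations (2 remaining named inputs: hLiu418 = stmt-HodgeConjecture-24832, h413 = stmt-HodgeConjecture-24833)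
until rung 0 closes; count-neutral (a by-`N` re-cut of (12-D) is the dealer's pen; this pays its `N ≤ 2` leaf by name).

References: [HarishChandra1999AdmissibleDistributions] Harish-Chandra (DeBacker–Sally) (1999), Thm. 16.3 p. 77, §18 pp. 78–79; [Rogawski1990] Rogawski (1990), §3.1 p. 19,
§3.8 p. 34; [Borel1991] Borel, *Linear Algebraic Groups* (1991), I.4 (4.2)–(4.4).
-/

set_option autoImplicit false
set_option linter.dupNamespace false   -- `Summit.HodgeConjecture.HodgeConjecture.…` (D-0017 nested layout; lakefile exemption for Summits)

noncomputable section

open MeasureTheory MeasureTheory.Measure Filter Topology Polynomial NumberField IsDedekindDomain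
open scoped Matrix MatrixGroups NNReal
open Literature.NumberTheory.Rogawski1990 Literature.NumberTheory.Automorphic Literature.NumberTheory.Automorphic.UnitaryGroup
open Literature.NumberTheory.GaloisRepresentations Literature.NumberTheory.GaloisRepresentations.IsNonarchimedeanLocalField
open Summit.HodgeConjecture.HodgeConjecture.Cruxes.H413.K2E3LieUnitary

namespace Summit.HodgeConjecture.HodgeConjecture.Cruxes.H413.K2E3NormalizedCharBddNearSingularDescentLeTwo

set_option maxHeartbeats 1600000 in
set_option synthInstance.maxHeartbeats 400000 in
open scoped Classical in
/-- **(12D-le2) — (12-D) `sig_K2E3NormalizedCharBddNearSingularDescent` FOR `N ≤ 2`, VACUOUSLY**: a semisimple `s ∈ U_N(H)(L⁺_v)` with `N ≤ 2` is regular or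
central, so the socket's hypotheses `¬ IsRegularElt s`, `s ∉ Z` cannot both hold (★ `mem_center_cmDatum_local_of_le_one` for `N ≤ 1`, ★
`mem_center_of_isSemisimple_of_not_isRegularElt` for `N = 2`).  Statement = the socket's bytes with `(N : ℕ), N ≤ 2 → ∀ (H …)`.
[cite: HarishChandra1999AdmissibleDistributions, Thm. 16.3 p. 77, §18 pp. 78–79] [cite: Rogawski1990, §3.1 p. 19] [cite: Borel1991, I.4 (4.2)–(4.4)] -/
theorem normalizedCharBddNearSingularDescent_of_le_two :
    ∀ (L : Type) [Field L] [NumberField L] [IsCMField L] (N : ℕ), N ≤ 2 → ∀ (H : Matrix (Fin N) (Fin N) L),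
      (H.map (cmConjRingHom L))ᵀ = H → H.det ≠ 0 →
      ∀ (v : HeightOneSpectrum (𝓞 ↥(maximalRealSubfield L)))
        [MeasurableSpace ((UnitaryGroup.cmDatum L N H).Local v)] [BorelSpace ((UnitaryGroup.cmDatum L N H).Local v)]
        (μ : Measure ((UnitaryGroup.cmDatum L N H).Local v)) [μ.IsHaarMeasure]
        (c : IrrClass ((UnitaryGroup.cmDatum L N H).Local v)) (Θ : (UnitaryGroup.cmDatum L N H).Local v → ℂ),
        LocallyIntegrable Θ μ →
        (∀ x : (UnitaryGroup.cmDatum L N H).Local v,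
          IsRegularElt (x.val : GL (Fin N) (UnitaryGroup.LocalRing L v)) → ∀ᶠ y in 𝓝 x, Θ y = Θ x) →
        (∀ φ : (UnitaryGroup.cmDatum L N H).Local v → ℂ, IsLocSmooth φ → c.smoothTrace μ φ = ∫ x, φ x * Θ x ∂μ) →
      ∀ s : (UnitaryGroup.cmDatum L N H).Local v, Module.End.IsSemisimple (Matrix.toLin' ((s.val : GL (Fin N) (UnitaryGroup.LocalRing L v)).val : Matrix (Fin N) (Fin N) (UnitaryGroup.LocalRing L v))) →
        ¬ IsRegularElt (s.val : GL (Fin N) (UnitaryGroup.LocalRing L v)) → s ∉ Subgroup.center ((UnitaryGroup.cmDatum L N H).Local v) →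
        ∃ U : Set ((UnitaryGroup.cmDatum L N H).Local v), IsOpen U ∧ s ∈ U ∧
        ∃ B : ℝ, ∀ g ∈ U, ∀ u : (UnitaryGroup.LocalRing L v)ˣ,
          (u : UnitaryGroup.LocalRing L v) *
              (((g.val : GL (Fin N) (UnitaryGroup.LocalRing L v)).val : Matrix (Fin N) (Fin N) (UnitaryGroup.LocalRing L v)).det) ^ (N - 1) =
            (((g.val : GL (Fin N) (UnitaryGroup.LocalRing L v)).val : Matrix (Fin N) (Fin N) (UnitaryGroup.LocalRing L v)).charpoly).discr →
          ((NNReal.sqrt (NNReal.sqrt (unitModulusChar (UnitaryGroup.LocalRing L v) u)) : ℝ≥0) : ℝ) * ‖Θ g‖ ≤ B := by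
  intro L _ _ _ N hN H hH hHd v _ _ μ _ c Θ _ _ _ s hss hns hsz
  exfalso
  rcases Nat.lt_or_ge N 2 with hN2 | hN2
  · exact hsz (K2E3CharLocIntNearSemisimpleLeOne.mem_center_cmDatum_local_of_le_one L N H v (by omega) s)
  · obtain rfl : N = 2 := le_antisymm hN hN2
    exact hsz (K2E3CharLocIntNearSemisimpleTwoOfIdentity.mem_center_of_isSemisimple_of_not_isRegularElt L H v hH hHd s hss hns)

end Summit.HodgeConjecture.HodgeConjecture.Cruxes.H413.K2E3NormalizedCharBddNearSingularDescentLeTwo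

end
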